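import Mathlib.RingTheory.PowerSeries.Substitution
import Mathlib.RingTheory.PowerSeries.Expand
import Mathlib.RingTheory.PowerSeries.Derivative
import Mathlib.RingTheory.PowerSeries.Trunc
import Mathlib.RingTheory.PowerSeries.Order
import Mathlib.RingTheory.PowerSeries.NoZeroDivisors
import Mathlib.Algebra.Polynomial.Taylor
import Mathlib.Algebra.CharP.Frobenius
import Mathlib.Algebra.CharP.Quotient
import Mathlib.RingTheory.Ideal.Quotient.Basic
import Mathlib.NumberTheory.Padics.RingHoms
import Mathlib.RingTheory.WittVector.Identities
import Mathlib.RingTheory.WittVector.Domain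
import Mathlib.FieldTheory.Perfect
import Literature.NumberTheory.EllipticCurves.DivisionPolynomialFormalMulProofs
import Literature.NumberTheory.EllipticCurves.FormalGroupHasseInvariantProofs
import Literature.RingTheory.FormalGroups.FunctionalEquationIntegrality
import Literature.NumberTheory.EllipticCurves.FormalGroupMultiplicationUniversalProofs
import Literature.NumberTheory.EllipticCurves.FormalGroupLogHomProofs
import Literature.RingTheory.FormalGroups.HondaTypeTransport
import Literature.NumberTheory.EllipticCurves.FormalMulTwoSecondCoeffProofs
import Mathlib.RingTheory.WittVector.FrobeniusFractionField
import Mathlib.RingTheory.WittVector.Compare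
import Mathlib.FieldTheory.Finite.Basic
import Literature.NumberTheory.EllipticCurves.FormalLogExpBaseChangeProofs
import Literature.NumberTheory.EllipticCurves.PAdicLFunction
import Literature.NumberTheory.EllipticCurves.PAdicGrossZagierConstantTermProofs
import Literature.NumberTheory.EllipticCurves.Greenberg1999.TwoTorsionMuInvariant
import Summits.BirchSwinnertonDyer.BirchSwinnertonDyer.Theorems.EisensteinDepletionAtTwoStarGO2KEtaTheoremKPadicB
import HarnessLib

/-!
# THEOREM K (the 2-adic Kummer class law for `z²(x(z) − x₀)`), kernel formalisation — KEtaLineAdapter (part 9)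
(crux `StarGO2Sigma`, stmt-BirchSwinnertonDyer-27046; line kummer, research stub `stub_discrepancyCover`)

Planner bsd-rank2-p2 GEN 37's Stage G of the monolith `KummerTheoremK_full.lean` (HOME/p2/g37/lean, lean rc 0, 0 sorries).
THE LINE ADAPTER: from the kummer skeleton's binders (`W : WeierstrassCurve ℚ` globally minimal, `IsOrdinaryAt W 2`,
`HasRationalTwoTorsionX W x₀`, `¬TwoTorsionRamifiedAtTwo x₀`) to the binders of part 8's `theoremK_line`
(`integralModelInt W`, elliptic special fibre at 2, `Odd a₁`): `isElliptic_specialFibre_two` (good reduction ⇒ elliptic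
special fibre, tree `not_dvd_minimalDiscriminantInt_of_hasGoodReductionAtPrime`), `frobeniusTrace_two_eq_tr` (the tree's
`a₂(W)` IS the Hasse–Manin trace of the special fibre), `odd_a₁_integralModelInt_of_isOrdinaryAt`, the one-stop
`theoremK_line_of_isOrdinaryAt`, and `unitRoot_unique` (the unit root of `X² − aX + 2` in `ℤ₂` is unique, to identify
THEOREM K's `α` with any other presentation of the unit root).  Nothing here reads `r_an`; `StarGO2Sigma` / E1M / BSD are
NOT proved by this file.
-/

set_option linter.dupNamespace false
set_option linter.unusedSectionVars false
set_option autoImplicit false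

noncomputable section


/-! ## LINE ADAPTER — from the kummer line's binders (`W : WeierstrassCurve ℚ` globally minimal,
`IsOrdinaryAt W 2`, `HasRationalTwoTorsionX W x₀`, `¬TwoTorsionRamifiedAtTwo x₀`) to the binders of
`theoremK_line` (`integralModelInt W : WeierstrassCurve ℤ`, elliptic special fibre at `2`, `Odd a₁`).

* `isElliptic_specialFibre_two` : good reduction at `2` ⇒ the special fibre of `integralModelInt W` at `2`
  is an elliptic curve over `𝔽₂` (tree `not_dvd_minimalDiscriminantInt_of_hasGoodReductionAtPrime`);
* `frobeniusTrace_two_eq_tr` : `W.frobeniusTrace 2 = HasseManin.tr` of that special fibre (both are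
  `q + 1 − #Ẽ(𝔽₂)` with the same point type);
* `odd_a₁_integralModelInt_of_isOrdinaryAt` : `IsOrdinaryAt W 2` ⇒ `Odd (integralModelInt W).a₁`
  (`2 ∤ a₂(W)` and `tr ≡ a₁ (mod 2)`, part 8 `odd_tr_iff_odd_a₁`). -/

namespace Summit.BirchSwinnertonDyer.BirchSwinnertonDyer.Theorems.DepletionAtTwo.KEta.LineAdapter

open PowerSeries WeierstrassCurve Literature.NumberTheory.EllipticCurves

variable (W : WeierstrassCurve ℚ) [W.IsElliptic] [W.IsGloballyMinimal]

/-- Reducing the minimal model along `ℤ → ℤ₂ → 𝔽₂` is reducing it along `ℤ → 𝔽₂`. -/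
theorem map_integralModelInt_padicInt_toZMod :
    ((integralModelInt W).map (Int.castRingHom ℤ_[2])).map (PadicInt.toZMod (p := 2)) =
      (integralModelInt W).map (Int.castRingHom (ZMod 2)) := by
  rw [WeierstrassCurve.map_map,
    RingHom.ext_int ((PadicInt.toZMod (p := 2)).comp (Int.castRingHom ℤ_[2])) (Int.castRingHom (ZMod 2))]

/-- Good reduction at `2` ⇒ the reduction of the integral minimal model modulo `2` is elliptic. -/
theorem isElliptic_map_integralModelInt_zmod_two (hgood : W.HasGoodReductionAtPrime 2) :
    ((integralModelInt W).map (Int.castRingHom (ZMod 2))).IsElliptic := by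
  have hΔ : ¬ ((2 : ℕ) : ℤ) ∣ minimalDiscriminantInt W :=
    not_dvd_minimalDiscriminantInt_of_hasGoodReductionAtPrime (W := W) 2 hgood
  have hne : ((minimalDiscriminantInt W : ℤ) : ZMod 2) ≠ 0 := by
    rw [Ne, ZMod.intCast_zmod_eq_zero_iff_dvd]
    exact_mod_cast hΔ
  refine ⟨?_⟩
  rw [WeierstrassCurve.map_Δ, eq_intCast]
  exact Ne.isUnit hne

/-- The same, in the `ℤ → ℤ₂ → 𝔽₂` form used by THEOREM K. -/
theorem isElliptic_specialFibre_two (hgood : W.HasGoodReductionAtPrime 2) :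
    (((integralModelInt W).map (Int.castRingHom ℤ_[2])).map (PadicInt.toZMod (p := 2))).IsElliptic := by
  rw [map_integralModelInt_padicInt_toZMod]
  exact isElliptic_map_integralModelInt_zmod_two W hgood

/-- `a₂(W) := 2 + 1 − #Ẽ(𝔽₂)` (tree `frobeniusTrace`) is the Hasse–Manin trace of the special fibre. -/
theorem frobeniusTrace_two_eq_tr :
    W.frobeniusTrace 2 = HasseManin.tr ((integralModelInt W).map (Int.castRingHom (ZMod 2))) := by
  simp only [frobeniusTrace, reductionPointCount, HasseManin.tr, ZMod.card, Nat.cast_ofNat]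

/-- `frobeniusTrace W 2` is the Hasse–Manin trace of the special fibre presented as the `ℤ₂ → 𝔽₂` reduction. -/
theorem frobeniusTrace_two_eq_tr' :
    W.frobeniusTrace 2 =
      HasseManin.tr (((integralModelInt W).map (Int.castRingHom ℤ_[2])).map (PadicInt.toZMod (p := 2))) := by
  rw [map_integralModelInt_padicInt_toZMod, frobeniusTrace_two_eq_tr]

/-- `IsOrdinaryAt W 2` ⇒ `a₁` of the minimal model is odd (`2 ∤ a₂(W) ≡ a₁`). -/
theorem odd_a₁_integralModelInt_of_isOrdinaryAt (hord : IsOrdinaryAt W 2) : Odd (integralModelInt W).a₁ := by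
  haveI := isElliptic_specialFibre_two W hord.1
  have h2 : ¬ (2 : ℤ) ∣ W.frobeniusTrace 2 := by exact_mod_cast hord.2
  have hodd : Odd (W.frobeniusTrace 2) :=
    Int.not_even_iff_odd.mp fun h => h2 (even_iff_two_dvd.mp h)
  rw [frobeniusTrace_two_eq_tr'] at hodd
  exact (TheoremKPadic.odd_tr_iff_odd_a₁ (integralModelInt W)).mp hodd

/-- The rational `2`-torsion abscissa of `W` is one of its integral model (`map_integralModelInt`). -/
theorem hasRationalTwoTorsionX_integralModelInt {x₀ : ℚ} (hx : Greenberg1999.HasRationalTwoTorsionX W x₀) :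
    Greenberg1999.HasRationalTwoTorsionX ((integralModelInt W).map (Int.castRingHom ℚ)) x₀ := by
  rwa [map_integralModelInt]

/-- **THEOREM K on the kummer line's binders.**  For `W / ℚ` globally minimal, ordinary (with good
reduction) at `2`, and a rational `2`-torsion abscissa `x₀` with `v₂(x₀) ≥ 0`: the conclusion of
`theoremK_line` for `integralModelInt W`, the unit root equation being `α² − a₂(W)·α + 2 = 0` up to
`frobeniusTrace_two_eq_tr'`.  The instance binder is discharged by `isElliptic_specialFibre_two W hord.1`. -/
theorem theoremK_line_of_isOrdinaryAt (hord : IsOrdinaryAt W 2)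
    [((( integralModelInt W).map (Int.castRingHom ℤ_[2])).map (PadicInt.toZMod (p := 2))).IsElliptic]
    {x₀ : ℚ} (hx : Greenberg1999.HasRationalTwoTorsionX W x₀) (hv : ¬ Greenberg1999.TwoTorsionRamifiedAtTwo x₀) :
    ∃ (α : ℤ_[2]) (hαn : ‖α‖ = 1)
      (hroot : (α : ℚ_[2]) ^ 2 -
        ((Literature.NumberTheory.EllipticCurves.HasseManin.tr
            (((integralModelInt W).map (Int.castRingHom ℤ_[2])).map (PadicInt.toZMod (p := 2))) : ℤ) : ℚ_[2]) *
          α + 2 = 0)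
      (ξ : ℤ_[2]), (ξ : ℚ_[2]) = ((x₀ : ℚ) : ℚ_[2]) ∧
    ∃ sbar : PowerSeries (ZMod 2), constantCoeff sbar = 0 ∧
      sbar - sbar ^ 2 =
        (WittExistence.lamInt (integralModelInt W) _ hαn hroot
          (TheoremKPadic.hondaType_of_goodReduction (integralModelInt W))).map (PadicInt.toZMod (p := 2)) ∧
      ∀ z : PowerSeries ℤ_[2], constantCoeff z = 0 →
        ∃ dz δgz : PowerSeries ℤ_[2],
          Kernel.phi (RingHom.id ℤ_[2]) z = z ^ 2 + 2 * dz ∧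
          Kernel.phi (RingHom.id ℤ_[2])
              ((((integralModelInt W).map (Int.castRingHom ℤ_[2])).formalXMulSq - C ξ * X ^ 2).subst z) =
            ((((integralModelInt W).map (Int.castRingHom ℤ_[2])).formalXMulSq - C ξ * X ^ 2).subst z) ^ 2 +
              2 * δgz ∧
          δgz.map (PadicInt.toZMod (p := 2)) =
            (PowerSeries.map (PadicInt.toZMod (p := 2))
                ((((integralModelInt W).map (Int.castRingHom ℤ_[2])).formalXMulSq - C ξ * X ^ 2).subst z)) ^ 2 *
              (sbar.subst (z.map (PadicInt.toZMod (p := 2))) +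
                (((((integralModelInt W).map (Int.castRingHom ℤ_[2])).formalInvDiff).map
                      (PadicInt.toZMod (p := 2))).subst (z.map (PadicInt.toZMod (p := 2)))) ^ 2 *
                  dz.map (PadicInt.toZMod (p := 2))) :=
  TheoremKPadic.theoremK_line (integralModelInt W) (odd_a₁_integralModelInt_of_isOrdinaryAt W hord)
    (hasRationalTwoTorsionX_integralModelInt W hx) hv

/-- The unit root is unique, hence equals the tree's `unitRoot W 2` whenever that is characterised
by the same equation: uniqueness of a unit root of `X² − aX + 2` in `ℤ₂` for odd `a`. -/
theorem unitRoot_unique {a : ℤ} {α β : ℤ_[2]} (hα : ‖α‖ = 1) (hβ : ‖β‖ = 1)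
    (hαr : (α : ℚ_[2]) ^ 2 - a * α + 2 = 0) (hβr : (β : ℚ_[2]) ^ 2 - a * β + 2 = 0) : α = β := by
  have key : ∀ γ : ℤ_[2], (γ : ℚ_[2]) ^ 2 - a * γ + 2 = 0 → γ * (γ - a) + 2 = 0 := fun γ hγ => by
    refine (PadicInt.coe_eq_zero (p := 2)).mp ?_
    show PadicInt.Coe.ringHom (p := 2) (γ * (γ - a) + 2) = 0
    rw [map_add, map_mul, map_sub, map_intCast, map_ofNat]
    show (γ : ℚ_[2]) * ((γ : ℚ_[2]) - a) + 2 = 0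
    linear_combination hγ
  have hα' := key α hαr
  have hβ' := key β hβr
  have h2 : ‖(2 : ℤ_[2])‖ < 1 := by
    rw [show (2 : ℤ_[2]) = ((2 : ℤ) : ℤ_[2]) by push_cast; rfl, PadicInt.norm_int_lt_one_iff_dvd]
    norm_num
  -- `‖α − a‖ = ‖2‖ < 1`
  have hαa : ‖α - (a : ℤ_[2])‖ < 1 := by
    have h := congrArg (‖·‖) (eq_neg_of_add_eq_zero_left hα')
    simp only [norm_mul, norm_neg, hα, one_mul] at h
    rw [h]; exact h2
  -- `‖β + (α − a)‖ = 1`, so it is a unit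
  have hsum : ‖β + (α - a)‖ = 1 := by
    refine le_antisymm (PadicInt.norm_le_one _) (not_lt.mp fun hlt => ?_)
    have e : β = (β + (α - a)) + -(α - a) := by ring
    have h : ‖β‖ < 1 := by
      rw [e]
      exact lt_of_le_of_lt (PadicInt.nonarchimedean _ _) (max_lt hlt (by rwa [norm_neg]))
    rw [hβ] at h
    exact lt_irrefl _ h
  have hunit : IsUnit (β + (α - a)) := PadicInt.isUnit_iff.mpr hsum
  have hprod : (α - β) * (β + (α - a)) = 0 := by linear_combination hα' - hβ'
  exact sub_eq_zero.mp ((mul_eq_zero.mp hprod).resolve_right hunit.ne_zero)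

end Summit.BirchSwinnertonDyer.BirchSwinnertonDyer.Theorems.DepletionAtTwo.KEta.LineAdapter
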